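import Summits.QuantumAdvantage.QuantumAdvantage.Theorems.SignedCubicForrelationNotPrBPP.Negative.HalfQuadMachine

/-!
# `SignedCubicForrelationNotPrBPP` — negative knowledge: with ONE QUADRATIC side the sign is classical

Sequel and conclusion of `HalfQuadMachine.lean` (crux `stmt-QuantumAdvantage-13931`, standing disprover
`refuter-cdisprove-stmt-QuantumAdvantage-13931-0`, 2026-08-16).

**Theorem (`signedHalfQuadProblem_mem_PromiseBPP'`).** SIGNED explicit 2-fold Forrelation — YES
`Φ ≥ 3/5`, NO `Φ ≤ -3/5`, `k = 2`, `B₂`-circuits — restricted to instances in which circuit `C_j`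
(`j ∈ {0,1}`) computes a function of 𝔽₂-degree `≤ 2`, the OTHER CIRCUIT BEING ARBITRARY, is in textbook
`PromiseBPP'`. Corollaries for the crux `X = SignedCubicForrelationNotPrBPP` (degree `≤ 3` on both
sides, `n` even): its sub-promise "circuit `j` quadratic" is classical, sign included
(`signedCubic_quadAt_mem_PromiseBPP'`), and the degree-2 rung of the disprover's lattice
(`XAtDegree 2` in `Cruxes/SignedCubicForrelationNotPrBPP/Disproof.lean`) is FALSE
(`signedDegTwoProblem_mem_PromiseBPP'`). So any hardness of the sign needs degree EXACTLY `3` on BOTH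
sides — compare the unsigned rung, classical for cubic pairs by the `Φ²`-estimator
(`CubicDequant.cubicKForrelationProblem_two_mem_PromiseBPP'`), which is blind to exactly the sign.

Contents: one round of the machine is `4ⁿ Z` (`roundY_eq`, through `TOf_eq_walsh`, `TOf_uOf_ne_zero`,
`TOf_uOf_dvd`), its sum `4ⁿ Σ_r Z(block r)` (`sumY_eq`); Chebyshev over `N = 16` independent blocks
(`CubicDequant.card_deviation_mul_sq_le'`) bounds the deviating block tuples (`card_deviates_le`), whence
`good_yes` (`Φ ≥ 3/5`) and `bad_no` (`Φ ≤ -3/5`); `accept_iff`, `uniformProb_accept_eq` (prefix events +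
`BravyiGosset.cnt_blocks`), `prob_yes` / `prob_no` (guard from `CubicDequant.guard_of_isYes`; a failing
guard rejects, which is correct on NO); the problems `signedHalfQuadProblem j` and the membership theorems.

## References

* [AaronsonAmbainis2018] S. Aaronson, A. Ambainis, Forrelation, SIAM J. Comput. 47 (2018), §1.1.1,
  §3.2 Prop. 6 (the sign-sensitive quantum test), §6.
* [MacWilliamsSloane1977] F. J. MacWilliams, N. J. A. Sloane, The Theory of Error-Correcting Codes,
  Ch. 15 §2 (Dickson; Walsh spectra of quadratic forms).
* [BravyiGosset2016] S. Bravyi, D. Gosset, PRL 116 (2016) 250501, App. A (quadratic Gauss sums).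
* [AroraBarak2009] S. Arora, B. Barak, Computational Complexity, §1.3, §7.4.1, Lemma A.12 (Chebyshev).
* [Goldreich2006] O. Goldreich, On promise problems, Def. 1.2.
* [Carlet2020] C. Carlet, Boolean Functions for Cryptography and Coding Theory, §2.2.1.
-/

noncomputable section

namespace Summit.QuantumAdvantage.QuantumAdvantage.Theorems.SignedCubicForrelationNotPrBPP.Negative

namespace HalfQuad

open _root_.Computability Literature.Computability.Complexity Literature.Computability.Complexity.CodeFP
open Literature.Computability.Complexity.Brick
open Literature.Computability.QuantumComplexity
open ForrCode QuadSampler CubicDequant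
open Literature.Computability.Complexity.F2Elim (bxorL bitsE)

/-! ### The machine's round is the statistic -/

section Machine

open Finset

variable {m : ℕ}

/-- **One round of the machine is `4ᵐ · Z(w)`** on its coins (`Q` quadratic: the sampler is exact, the
Gauss sum is `W_Q(u)`, non-zero, a signed power of two dividing `8ᵐ`). [cite: AaronsonAmbainis2018, §1.1.1] -/
theorem roundY_eq (S Q : Circuit (Fin m)) (hQ : IsDegLeFun 2 Q.eval) (w : Fin m → Bool) :
    (roundY m (pcircOf S) (pcircOf Q) (List.ofFn w) : ℝ) = (4 : ℝ) ^ m * Zst S.eval Q.eval w := by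
  have hq := lowDeg_two_of_isDegLeFun hQ
  rw [roundY, evalP_pcircOf_eq_liftQ Q]
  set uL := uOf (liftQ Q.eval) m (List.ofFn w) with huL
  have hu : toInput m uL = uV Q.eval w := rfl
  have hT : (TOf (liftQ Q.eval) m uL : ℝ) = walsh Q.eval (uV Q.eval w) := by
    rw [TOf_eq_walsh hq (length_uOf _ _).le, hu]
  have hne : TOf (liftQ Q.eval) m uL ≠ 0 := TOf_uOf_ne_zero hq w
  have hdvd : TOf (liftQ Q.eval) m uL ∣ (8 : ℤ) ^ m := TOf_uOf_dvd hq w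
  have hS : evalP (pcircOf S) uL = S.eval (uV Q.eval w) := by rw [evalP_pcircOf_eq, hu]
  rw [hS, Int.cast_mul, Int.cast_div hdvd (by exact_mod_cast hne), hT, Zst]
  have h8 : (((8 : ℤ) ^ m : ℤ) : ℝ) = (4 : ℝ) ^ m * 2 ^ m := by push_cast; rw [← mul_pow]; norm_num
  rw [h8]
  cases S.eval (uV Q.eval w) <;> simp [signOf] <;> ring

/-- **The machine's sum is `4ᵐ Σ_r Z(block r)`** (blocks of `m` coins). [cite: AaronsonAmbainis2018, §1.1.1] -/
theorem sumY_eq (S Q : Circuit (Fin m)) (hQ : IsDegLeFun 2 Q.eval) (y : List Bool) :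
    (sumY m (pcircOf S) (pcircOf Q) y : ℝ) =
      (4 : ℝ) ^ m * ∑ r : Fin N, Zst S.eval Q.eval (BravyiGosset.blocksOf m y N r) := by
  rw [sumY, list_sum_map_range_eq, Int.cast_sum, mul_sum]
  refine sum_congr rfl fun r _ => ?_
  rw [roundAt, coinVec_eq_ofFn]
  exact roundY_eq S Q hQ _

/-- Extra coins do not matter. [folklore] -/
theorem sumY_append (cS cQ : PCirc) (y z : List Bool) (hy : y.length = N * m) :
    sumY m cS cQ (y ++ z) = sumY m cS cQ y := by
  unfold sumY
  congr 1
  refine List.map_congr_left fun r hr => ?_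
  rw [List.mem_range] at hr
  unfold roundAt
  rw [coinVec_append y z (by nlinarith)]

end Machine

/-! ### The acceptance event and the two bounds -/

section Bounds

open Finset
open scoped Classical

variable {m : ℕ}

/-- The threshold event on block tuples: `Σ_r Zₙ(ω_r) > 0`. [folklore] -/
def Good (f g : (Fin m → Bool) → Bool) (ω : Fin N → Fin m → Bool) : Prop := 0 < ∑ r, Zn f g (ω r)

/-- `Σ Zₙ > 0 ↔ Σ Z > 0`. [folklore] -/
theorem good_iff (f g : (Fin m → Bool) → Bool) (ω : Fin N → Fin m → Bool) :
    Good f g ω ↔ 0 < ∑ r, Zst f g (ω r) := by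
  unfold Good Zn
  rw [← sum_mul]
  have hs : (0 : ℝ) < (Real.sqrt ((2 : ℝ) ^ m))⁻¹ := inv_pos.2 (Real.sqrt_pos.2 (by positivity))
  constructor
  · intro h
    by_contra hle
    push Not at hle
    have := mul_nonpos_of_nonpos_of_nonneg hle hs.le
    linarith
  · intro h; exact mul_pos h hs

/-- `25 ≤ 0.12 · N²/… `: the numerical heart, `3 · 25 ≤ 9 · N` fails but `75 ≤ 9 N` holds for `N = 16`. [folklore] -/
theorem N_large : (75 : ℝ) ≤ 9 * N := by rw [N]; norm_num

/-- **Chebyshev for the estimator**: the deviating tuples (`|Σ Zₙ - N Φ| ≥ 3N/5`) are few: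
`3 · #dev ≤ 2^{mN}`. [cite: AroraBarak2009, Lemma A.12] -/
theorem card_deviates_le {f g : (Fin m → Bool) → Bool} (hg : IsDegLeFun 2 g) :
    3 * ((univ.filter fun ω : Fin N → Fin m → Bool =>
        3 * (N : ℝ) / 5 ≤ |∑ i, Zn f g (ω i) - N * forrelation f g|).card : ℝ) ≤ 2 ^ (m * N) := by
  have h := card_deviation_mul_sq_le' (L := N) (Zn f g) (forrelation f g) 1 (sum_Zn_eq hg) (sum_Zn_sq_le hg)
    (3 * N / 5) (by rw [N]; norm_num)
  have hN : (N : ℝ) = 16 := by rw [N]; norm_num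
  rw [hN] at h ⊢
  set c := ((univ.filter fun ω : Fin N → Fin m → Bool =>
        3 * (16 : ℝ) / 5 ≤ |∑ i, Zn f g (ω i) - 16 * forrelation f g|).card : ℝ)
  have hp : (0 : ℝ) ≤ 2 ^ (m * N) := by positivity
  nlinarith [h]

/-- **Yes side**: `Φ ≥ 3/5` ⇒ at least `2/3` of the block tuples are good. [cite: AaronsonAmbainis2018, §1.1.3] -/
theorem good_yes {f g : (Fin m → Bool) → Bool} (hg : IsDegLeFun 2 g) (hΦ : 3 / 5 ≤ forrelation f g) :
    2 * (2 : ℝ) ^ (m * N) ≤ 3 * ((univ.filter fun ω : Fin N → Fin m → Bool => Good f g ω).card : ℝ) := by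
  have hdev := card_deviates_le (f := f) hg
  set μ := forrelation f g
  have hsub : (univ.filter fun ω : Fin N → Fin m → Bool => ¬ Good f g ω) ⊆
      univ.filter fun ω => 3 * (N : ℝ) / 5 ≤ |∑ i, Zn f g (ω i) - N * μ| := by
    intro ω hω
    rw [mem_filter] at hω ⊢
    refine ⟨mem_univ _, ?_⟩
    have hng : ¬ (0 < ∑ r, Zn f g (ω r)) := hω.2
    push Not at hng
    have hN : (0 : ℝ) < N := by rw [N]; norm_num
    rw [abs_sub_comm, abs_of_nonneg (by nlinarith)]
    nlinarith
  have hcard := card_le_card hsub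
  have htot := Finset.card_filter_add_card_filter_not (s := (univ : Finset (Fin N → Fin m → Bool))) (fun ω => Good f g ω)
  rw [card_univ, Fintype.card_fun, Fintype.card_fin, Fintype.card_fun, Fintype.card_bool, Fintype.card_fin] at htot
  have htot' : (((univ.filter fun ω : Fin N → Fin m → Bool => Good f g ω).card : ℝ) +
      ((univ.filter fun ω : Fin N → Fin m → Bool => ¬ Good f g ω).card : ℝ)) = 2 ^ (m * N) := by
    rw [← pow_mul] at htot; exact_mod_cast htot
  have hcard' : ((univ.filter fun ω : Fin N → Fin m → Bool => ¬ Good f g ω).card : ℝ) ≤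
      ((univ.filter fun ω : Fin N → Fin m → Bool => 3 * (N : ℝ) / 5 ≤ |∑ i, Zn f g (ω i) - N * μ|).card : ℝ) := by
    exact_mod_cast hcard
  linarith [htot', hdev, hcard']

/-- **No side**: `Φ ≤ -3/5` ⇒ at least `2/3` of the block tuples are not good. [cite: AaronsonAmbainis2018, §1.1.3] -/
theorem bad_no {f g : (Fin m → Bool) → Bool} (hg : IsDegLeFun 2 g) (hΦ : forrelation f g ≤ -(3 / 5 : ℝ)) :
    2 * (2 : ℝ) ^ (m * N) ≤ 3 * ((univ.filter fun ω : Fin N → Fin m → Bool => ¬ Good f g ω).card : ℝ) := by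
  have hdev := card_deviates_le (f := f) hg
  set μ := forrelation f g
  have hsub : (univ.filter fun ω : Fin N → Fin m → Bool => Good f g ω) ⊆
      univ.filter fun ω => 3 * (N : ℝ) / 5 ≤ |∑ i, Zn f g (ω i) - N * μ| := by
    intro ω hω
    rw [mem_filter] at hω ⊢
    refine ⟨mem_univ _, ?_⟩
    have hgood : 0 < ∑ r, Zn f g (ω r) := hω.2
    have hN : (0 : ℝ) < N := by rw [N]; norm_num
    rw [abs_of_nonneg (by nlinarith)]
    nlinarith
  have hcard := card_le_card hsub
  have htot := Finset.card_filter_add_card_filter_not (s := (univ : Finset (Fin N → Fin m → Bool))) (fun ω => Good f g ω)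
  rw [card_univ, Fintype.card_fun, Fintype.card_fin, Fintype.card_fun, Fintype.card_bool, Fintype.card_fin] at htot
  have htot' : (((univ.filter fun ω : Fin N → Fin m → Bool => Good f g ω).card : ℝ) +
      ((univ.filter fun ω : Fin N → Fin m → Bool => ¬ Good f g ω).card : ℝ)) = 2 ^ (m * N) := by
    rw [← pow_mul] at htot; exact_mod_cast htot
  have hcard' : ((univ.filter fun ω : Fin N → Fin m → Bool => Good f g ω).card : ℝ) ≤
      ((univ.filter fun ω : Fin N → Fin m → Bool => 3 * (N : ℝ) / 5 ≤ |∑ i, Zn f g (ω i) - N * μ|).card : ℝ) := by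
    exact_mod_cast hcard
  linarith [htot', hdev, hcard']

end Bounds

/-! ### From the instance to the machine -/

section Instance

open Finset
open scoped Classical

variable (I : KForrelationInstance) (hk : I.k = 2)

include hk in
/-- **The machine accepts iff the block tuple of the coins is good** (under the guard, with the sign
circuit `S` at position `1 - j` and the quadratic circuit `Q` at position `j`).
[cite: AaronsonAmbainis2018, §1.1.3] -/
theorem accept_iff {j : ℕ} {S Q : Circuit (Fin I.n)} (hS : circAt (instOf I) (1 - j) = pcircOf S)
    (hQc : circAt (instOf I) j = pcircOf Q) (hQ : IsDegLeFun 2 Q.eval) {L : ℕ} (hn : I.n ≤ L + 1)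
    (y : List Bool) :
    accept j (instOf I) L y = true ↔ Good S.eval Q.eval (BravyiGosset.blocksOf I.n y N) := by
  have hnEff : nEff (instOf I) L = I.n := min_eq_left hn
  rw [accept, good_iff]
  simp only [Bool.and_eq_true, decide_eq_true_eq]
  rw [show (instOf I).2.1 = I.k from rfl, hk, show (instOf I).1 = I.n from rfl, hnEff, hS, hQc]
  simp only [true_and, hn]
  rw [← Int.cast_pos (R := ℝ), sumY_eq S Q hQ]
  have hpos : (0 : ℝ) < 4 ^ I.n := pow_pos (by norm_num) _
  constructor
  · intro h
    by_contra hle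
    push Not at hle
    have := mul_nonpos_of_nonneg_of_nonpos hpos.le hle
    linarith
  · intro h; exact mul_pos hpos h

/-- **Extra coins do not matter** (under the guard). [folklore] -/
theorem accept_append (j : ℕ) {L : ℕ} (hn : I.n ≤ L + 1) (y z : List Bool) (hy : y.length = N * I.n) :
    accept j (instOf I) L (y ++ z) = accept j (instOf I) L y := by
  have hnEff : nEff (instOf I) L = I.n := min_eq_left hn
  unfold accept
  rw [hnEff, sumY_append _ _ y z hy]

include hk in
/-- **From block tuples to coin strings**: the acceptance probability with `p(|x|)` coins is the
fraction of good block tuples. [folklore] -/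
theorem uniformProb_accept_eq {j : ℕ} {S Q : Circuit (Fin I.n)} (hS : circAt (instOf I) (1 - j) = pcircOf S)
    (hQc : circAt (instOf I) j = pcircOf Q) (hQ : IsDegLeFun 2 Q.eval) (hn : I.n ≤ I.encode.length + 1)
    (b : Bool) :
    uniformProb (coinPoly.eval I.encode.length) {y | accept j (instOf I) I.encode.length y = b} =
      ((univ.filter fun ω : Fin N → Fin I.n → Bool => decide (Good S.eval Q.eval ω) = b).card : ℝ) /
        2 ^ (N * I.n) := by
  have hm : N * I.n ≤ coinPoly.eval I.encode.length := by rw [coinPoly_eval]; nlinarith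
  rw [uniformProb_prefix hm _ (fun y z hy => by
    simp only [Set.mem_setOf_eq]; rw [accept_append I j hn y z hy])]
  rw [uniformProb_eq_cnt_div]
  congr 1
  have e1 : cnt (N * I.n) {y | accept j (instOf I) I.encode.length y = b} =
      cnt (N * I.n) {y | decide (Good S.eval Q.eval (BravyiGosset.blocksOf I.n y N)) = b} := by
    refine cnt_congr fun y _ => ?_
    simp only [Set.mem_setOf_eq]
    have := accept_iff I hk hS hQc hQ hn y
    cases hb : accept j (instOf I) I.encode.length y
    · rw [hb] at this
      have hng : ¬ Good S.eval Q.eval (BravyiGosset.blocksOf I.n y N) := fun hg' => by simpa using this.2 hg'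
      simp [hng]
    · rw [hb] at this
      simp [this.1 rfl]
  rw [e1, BravyiGosset.cnt_blocks I.n N fun ω => decide (Good S.eval Q.eval ω) = b]

include hk in
/-- **Yes-instances: acceptance probability `≥ 2/3`.** [cite: AaronsonAmbainis2018, §1.1.3] -/
theorem prob_yes {j : ℕ} {S Q : Circuit (Fin I.n)} (hS : circAt (instOf I) (1 - j) = pcircOf S)
    (hQc : circAt (instOf I) j = pcircOf Q) (hQ : IsDegLeFun 2 Q.eval) (hyes : I.IsYes)
    (hval : I.value = forrelation S.eval Q.eval) :
    (2 / 3 : ℝ) ≤ uniformProb (coinPoly.eval I.encode.length) {y | accept j (instOf I) I.encode.length y = true} := by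
  have hn := guard_of_isYes I hk hyes
  rw [uniformProb_accept_eq I hk hS hQc hQ hn true, le_div_iff₀ (by positivity)]
  have hΦ : 3 / 5 ≤ forrelation S.eval Q.eval := by rw [← hval]; exact hyes.2
  have := good_yes (f := S.eval) hQ hΦ
  rw [mul_comm N I.n]
  have e : (univ.filter fun ω : Fin N → Fin I.n → Bool => decide (Good S.eval Q.eval ω) = true) =
      univ.filter fun ω => Good S.eval Q.eval ω := by ext ω; simp
  rw [e]
  linarith

include hk in
/-- **No-instances: rejection probability `≥ 2/3`** (if the guard fails the machine rejects always).
[cite: AaronsonAmbainis2018, §1.1.3] -/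
theorem prob_no {j : ℕ} {S Q : Circuit (Fin I.n)} (hS : circAt (instOf I) (1 - j) = pcircOf S)
    (hQc : circAt (instOf I) j = pcircOf Q) (hQ : IsDegLeFun 2 Q.eval) (hno : I.value ≤ -(3 / 5 : ℝ))
    (hval : I.value = forrelation S.eval Q.eval) :
    (2 / 3 : ℝ) ≤ uniformProb (coinPoly.eval I.encode.length) {y | accept j (instOf I) I.encode.length y = false} := by
  by_cases hn : I.n ≤ I.encode.length + 1
  · rw [uniformProb_accept_eq I hk hS hQc hQ hn false, le_div_iff₀ (by positivity)]
    have hΦ : forrelation S.eval Q.eval ≤ -(3 / 5 : ℝ) := by rw [← hval]; exact hno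
    have := bad_no (f := S.eval) hQ hΦ
    rw [mul_comm N I.n]
    have e : (univ.filter fun ω : Fin N → Fin I.n → Bool => decide (Good S.eval Q.eval ω) = false) =
        univ.filter fun ω => ¬ Good S.eval Q.eval ω := by ext ω; simp
    rw [e]
    linarith
  · have hall : ∀ y : List Bool, accept j (instOf I) I.encode.length y = false := by
      intro y
      rw [accept, show (instOf I).1 = I.n from rfl]
      simp [hn]
    have : uniformProb (coinPoly.eval I.encode.length) {y | accept j (instOf I) I.encode.length y = false} = 1 := by
      rw [show {y : List Bool | accept j (instOf I) I.encode.length y = false} = Set.univ from Set.eq_univ_of_forall hall]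
      exact uniformProb_univ _
    rw [this]; norm_num

end Instance

/-! ### The promise problems and the membership theorems -/

section Problems

open scoped Classical

/-- YES side of SIGNED 2-fold Forrelation with circuit `j` quadratic: `B₂`-circuits, `Φ ≥ 3/5`, `k = 2`,
`deg C_j ≤ 2` — NO condition on the other circuit. [cite: AaronsonAmbainis2018, §1.1.3 and §6] -/
def halfQuadYes (j : ℕ) : Set KForrelationInstance :=
  {I | I.IsYes ∧ I.k = 2 ∧ ∀ i : Fin I.k, (i : ℕ) = j → IsDegLeFun 2 (I.C i).eval}

/-- NO side: `B₂`-circuits, `Φ ≤ -3/5`, `k = 2`, `deg C_j ≤ 2`. [cite: AaronsonAmbainis2018, §1.1.3 and §6] -/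
def halfQuadNo (j : ℕ) : Set KForrelationInstance :=
  {I | (I.IsOverB2 ∧ I.value ≤ -(3 / 5 : ℝ)) ∧ I.k = 2 ∧ ∀ i : Fin I.k, (i : ℕ) = j → IsDegLeFun 2 (I.C i).eval}

/-- **Signed 2-fold Forrelation with ONE quadratic side** (`j` = the quadratic circuit).
[cite: AaronsonAmbainis2018, §1.1.3 and §3.2 Prop. 6] -/
def signedHalfQuadProblem (j : ℕ) : PromiseProblem :=
  ⟨KForrelationInstance.encode '' halfQuadYes j, KForrelationInstance.encode '' halfQuadNo j⟩

/-- **Main theorem.** Signed 2-fold Forrelation with one quadratic circuit (the other arbitrary) is in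
textbook promise-`BPP`, for either position `j ∈ {0, 1}` of the quadratic circuit.
[cite: AaronsonAmbainis2018, §1.1.3 and §3.2 Prop. 6] -/
theorem signedHalfQuadProblem_mem_PromiseBPP' {j : ℕ} (hj : j < 2) : signedHalfQuadProblem j ∈ PromiseBPP' := by
  refine mem_PromiseBPP'_of_accept j _ coinPoly (fun I hI => ?_) (fun I hI => ?_)
    (by rintro x ⟨I, -, rfl⟩; exact ⟨I, rfl⟩) (by rintro x ⟨I, -, rfl⟩; exact ⟨I, rfl⟩)
  · obtain ⟨I', ⟨hyes, hk, hdeg⟩, hII'⟩ := hI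
    obtain rfl : I' = I := KForrelationInstance.encode_injective hII'
    interval_cases j
    · obtain ⟨hS, hQc⟩ := circuits_zero I' hk
      exact prob_yes I' hk hS hQc (hdeg ⟨0, by omega⟩ rfl) hyes
        ((value_eq_forrelation_fg I' hk).trans (forrelation_comm _ _))
    · obtain ⟨hS, hQc⟩ := circuits_one I' hk
      exact prob_yes I' hk hS hQc (hdeg ⟨1, by omega⟩ rfl) hyes (value_eq_forrelation_fg I' hk)
  · obtain ⟨I', ⟨⟨-, hno⟩, hk, hdeg⟩, hII'⟩ := hI
    obtain rfl : I' = I := KForrelationInstance.encode_injective hII'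
    interval_cases j
    · obtain ⟨hS, hQc⟩ := circuits_zero I' hk
      exact prob_no I' hk hS hQc (hdeg ⟨0, by omega⟩ rfl) hno
        ((value_eq_forrelation_fg I' hk).trans (forrelation_comm _ _))
    · obtain ⟨hS, hQc⟩ := circuits_one I' hk
      exact prob_no I' hk hS hQc (hdeg ⟨1, by omega⟩ rfl) hno (value_eq_forrelation_fg I' hk)

/-- **Corollary for the crux `X`.** The sub-promise of the route's signed cubic problem
`signedCubicForrelationProblem 2` in which circuit `j` moreover computes a QUADRATIC function is in
`PromiseBPP'`: on these instances the sign is classical. [cite: AaronsonAmbainis2018, §3.2 Prop. 6] -/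
theorem signedCubic_quadAt_mem_PromiseBPP' {j : ℕ} (hj : j < 2) :
    (⟨KForrelationInstance.encode ''
        {I | (I.IsYes ∧ I.k = 2 ∧ Even I.n ∧ ∀ i, IsDegLeFun 3 (I.C i).eval) ∧
          ∀ i : Fin I.k, (i : ℕ) = j → IsDegLeFun 2 (I.C i).eval},
      KForrelationInstance.encode ''
        {I | ((I.IsOverB2 ∧ I.value ≤ -(3 / 5 : ℝ)) ∧ I.k = 2 ∧ Even I.n ∧ ∀ i, IsDegLeFun 3 (I.C i).eval) ∧
          ∀ i : Fin I.k, (i : ℕ) = j → IsDegLeFun 2 (I.C i).eval}⟩ : PromiseProblem) ∈ PromiseBPP' := by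
  refine mem_PromiseBPP'_of_subset ?_ ?_ (signedHalfQuadProblem_mem_PromiseBPP' hj)
  · exact Set.image_mono fun I hI => ⟨hI.1.1, hI.1.2.1, hI.2⟩
  · exact Set.image_mono fun I hI => ⟨hI.1.1, hI.1.2.1, hI.2⟩

/-- **Corollary: the degree-2 rung is classical.** SIGNED QUADRATIC 2-fold Forrelation (both circuits of
degree `≤ 2`, `n` even) is in `PromiseBPP'` — the statement `XAtDegree 2` of the disprover's lattice
(`Cruxes/SignedCubicForrelationNotPrBPP/Disproof.lean`) is false. [cite: AaronsonAmbainis2018, §3.2 Prop. 6] -/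
theorem signedDegTwoProblem_mem_PromiseBPP' :
    (⟨KForrelationInstance.encode '' {I | I.IsYes ∧ I.k = 2 ∧ Even I.n ∧ ∀ i, IsDegLeFun 2 (I.C i).eval},
      KForrelationInstance.encode ''
        {I | (I.IsOverB2 ∧ I.value ≤ -(3 / 5 : ℝ)) ∧ I.k = 2 ∧ Even I.n ∧ ∀ i, IsDegLeFun 2 (I.C i).eval}⟩ :
      PromiseProblem) ∈ PromiseBPP' := by
  refine mem_PromiseBPP'_of_subset ?_ ?_ (signedHalfQuadProblem_mem_PromiseBPP' (j := 1) (by norm_num))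
  · exact Set.image_mono fun I hI => ⟨hI.1, hI.2.1, fun i _ => hI.2.2.2 i⟩
  · exact Set.image_mono fun I hI => ⟨hI.1, hI.2.1, fun i _ => hI.2.2.2 i⟩

end Problems

end HalfQuad

end Summit.QuantumAdvantage.QuantumAdvantage.Theorems.SignedCubicForrelationNotPrBPP.Negative

end
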